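import Summits.MatrixMultiplication.OmegaCensus.CentreIndexSixGroups
import Summits.MatrixMultiplication.OmegaCensus.DihC3SqDih

/-!
# ω-census, family (b3): conjecture C9 (c), class `[G:Z(G)] = 6` — the LOWER bound `α(G;|G|,3,3) ≥ (5/3)|G|` (kernel, every such group)

HONEST FRAMING (pub-omega census; verbatim): lottery ticket; floor = certified bounds/negative ranges.
Census BOOKKEEPING (conjecture C9 (c) of the cell — the value `r = 5/3` of the class `[G:Z(G)] = 6`; pub-omega stpp-1
gen 17): every finite group whose centre has index `6` has a `3 × 3` box `G × Y × W` carrying an independent cell set `J`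
(distinct cells have word `E P P' ≠ 1`) with `3|J| = 5|G|` (`exists_indep_five_thirds_of_index_center_six`).  With the kernel
law NR154 (`CentreIndexSix.three_mul_volume_le_of_index_center` / box form `three_mul_card_indep_le_basic`: `3|I| ≤ 5|G|`)
the box ratio of the class is EXACTLY `5/3`.

PROOF.  Same mechanism as `DihC3SqDih` (class `𝒞₂`): the coordinates `Coord c κ ε` (`exists_coord`) ARE a homomorphism
`π = (κ, [ε = −1]) : G →* S₃ = DihedralGroup 3` (`Coord.toD3Hom`; values identified through `κD`, `εD` of
`CentreIndexSixTPP`, which separate the six elements), onto because a non-commuting pair (`exists_not_comm`) yields an element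
of sign `−1` (two elements of sign `+1` commute; inlined); the `10`-cell independent set of the box `Y = {1, r, r²}`, `W = {1, r, s}` of `S₃`
(the cell's engine witness, NR138 `α_{S₃}(6,3,3) = 10`, checked here by `decide`) lifts along `π` (`DihC3Sq.exists_indep_lift`)
to `10 · |ker π| = 10|G|/6` independent cells.  Nothing here is progress on `ω`.
-/

namespace Summit.MatrixMultiplication.OmegaCensus.CentreIndexSix

open Finset

/-! ### `S₃ = DihedralGroup 3`: separation by `(κD, εD)` and the `10`-cell witness -/

/-- `(κD, εD)` separates the elements of `D₃`. [folklore] -/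
theorem D3_ext : ∀ d d' : DihedralGroup 3, κD d = κD d' → εD d = εD d' → d = d' := by decide

/-- The engine's `10`-cell witness of `S₃ = D₃` in the box `Y = {1, r, r²}`, `W = {1, r, s}` (as a list). [folklore] -/
def d3WitnessL : List (DihedralGroup 3 × DihedralGroup 3 × DihedralGroup 3) :=
  [(.r 0, .r 0, .r 1), (.r 0, .r 0, .sr 0), (.r 1, .r 1, .r 1), (.r 1, .r 1, .sr 0), (.r 2, .r 0, .r 0),
    (.sr 0, .r 0, .r 1), (.sr 0, .r 0, .sr 0), (.sr 1, .r 0, .r 0), (.sr 2, .r 1, .r 1), (.sr 2, .r 1, .sr 0)]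

/-- **`α(S₃; 6, 3, 3) ≥ 10`**: an independent `10`-cell set of a `3 × 3` box of `D₃` (kernel-checked). [folklore] -/
theorem D3_exists_indep_10 :
    ∃ (Y W : Finset (DihedralGroup 3)) (I : Finset (DihedralGroup 3 × DihedralGroup 3 × DihedralGroup 3)),
      #Y = 3 ∧ #W = 3 ∧ I ⊆ univ ×ˢ (Y ×ˢ W) ∧ (∀ P ∈ I, ∀ P' ∈ I, P ≠ P' → DihC3Sq.E2 P P' ≠ 1) ∧ #I = 10 :=
  ⟨{.r 0, .r 1, .r 2}, {.r 0, .r 1, .sr 0}, d3WitnessL.toFinset, by decide, by decide,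
    DihC3Sq.subset_box_of_inBoxB (by decide), DihC3Sq.indep_of_indepB (by decide), by decide⟩

namespace Coord

variable {G : Type*} [Group G] {c : G} {κ ε : G → ZMod 3} (h : Coord c κ ε)
include h

/-- Coordinates of the powers of `c`: `κ (cⁿ) = n`, `ε (cⁿ) = 1`. [folklore] -/
theorem kap_c_pow (n : ℕ) : κ (c ^ n) = (n : ZMod 3) ∧ ε (c ^ n) = 1 := by
  induction n with
  | zero => simp [h.kap_one, h.eps_one]
  | succ k ih => rw [pow_succ, h.kap_mul, h.eps_mul, ih.1, ih.2, h.kap_c, h.eps_c]; simp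

/-- The coordinate map `g ↦ r^{κ g}` (`ε g = 1`) / `s r^{κ g}` (`ε g = −1`) into `S₃ = D₃`. [folklore] -/
def toD3 (_h : Coord c κ ε) (g : G) : DihedralGroup 3 :=
  if ε g = 1 then DihedralGroup.r (κ g) else DihedralGroup.sr (-κ g)

/-- `toD3` has the prescribed coordinates. [folklore] -/
theorem coord_toD3 (g : G) : κD (h.toD3 g) = κ g ∧ εD (h.toD3 g) = ε g := by
  unfold toD3
  rcases h.sign g with e | e
  · rw [if_pos e, e]; exact ⟨rfl, rfl⟩
  · rw [if_neg (by rw [e]; decide), e]; exact ⟨neg_neg _, rfl⟩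

/-- The coordinate map is multiplicative (crossed-homomorphism law on both sides). [folklore] -/
theorem toD3_mul (g k : G) : h.toD3 (g * k) = h.toD3 g * h.toD3 k := by
  apply D3_ext
  · rw [(h.coord_toD3 _).1, coord_dihedral3.kap_mul, (h.coord_toD3 g).1, (h.coord_toD3 g).2, (h.coord_toD3 k).1, h.kap_mul]
  · rw [(h.coord_toD3 _).2, coord_dihedral3.eps_mul, (h.coord_toD3 g).2, (h.coord_toD3 k).2, h.eps_mul]

/-- The coordinate homomorphism `π : G →* S₃`. [folklore] -/
def toD3Hom (h : Coord c κ ε) : G →* DihedralGroup 3 :=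
  MonoidHom.mk' h.toD3 h.toD3_mul

/-- `π` is onto as soon as some element has sign `−1`. [folklore] -/
theorem toD3Hom_surjective {t : G} (ht : ε t = -1) : Function.Surjective h.toD3Hom := by
  intro d
  rcases d with i | j
  · refine ⟨c ^ i.val, D3_ext _ _ ?_ ?_⟩
    · show κD (h.toD3 _) = _
      rw [(h.coord_toD3 _).1, (h.kap_c_pow _).1, ZMod.natCast_zmod_val]; rfl
    · show εD (h.toD3 _) = _
      rw [(h.coord_toD3 _).2, (h.kap_c_pow _).2]; rfl
  · refine ⟨c ^ (-j - κ t).val * t, D3_ext _ _ ?_ ?_⟩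
    · show κD (h.toD3 _) = _
      rw [(h.coord_toD3 _).1, h.kap_mul, (h.kap_c_pow _).1, (h.kap_c_pow _).2, ZMod.natCast_zmod_val, one_mul,
        sub_add_cancel]
      rfl
    · show εD (h.toD3 _) = _
      rw [(h.coord_toD3 _).2, h.eps_mul, (h.kap_c_pow _).2, ht, one_mul]; rfl

/-- `|ker π| · 6 = |G|` when `π` is onto. [folklore] -/
theorem card_ker_mul [Fintype G] {t : G} (ht : ε t = -1) : Nat.card h.toD3Hom.ker * 6 = Fintype.card G := by
  have hidx : h.toD3Hom.ker.index = 6 := by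
    rw [Subgroup.index_ker, MonoidHom.range_eq_top_of_surjective _ (h.toD3Hom_surjective ht), Subgroup.card_top,
      Nat.card_eq_fintype_card, DihedralGroup.card]
  rw [← hidx, Subgroup.card_mul_index, Nat.card_eq_fintype_card]

/-- **Lower bound from coordinates.** With `Coord c κ ε` and a non-commuting pair there is a `3 × 3` box carrying an independent
cell set `J` with `3|J| = 5|G|`: the `10`-cell witness of `S₃` lifted along `π`. [folklore] -/
theorem exists_indep_five_thirds_of_ne [Fintype G] [DecidableEq G] {a b : G} (hab : a * b ≠ b * a) :
    ∃ (Y W : Finset G) (J : Finset (G × G × G)), #Y = 3 ∧ #W = 3 ∧ J ⊆ univ ×ˢ (Y ×ˢ W) ∧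
      (∀ P ∈ J, ∀ P' ∈ J, P ≠ P' → E P P' ≠ 1) ∧ 3 * #J = 5 * Fintype.card G := by
  classical
  -- a non-commuting pair exhibits an element of sign `−1` (two elements of sign `+1` commute)
  obtain ⟨t, ht⟩ : ∃ t, ε t = -1 := by
    by_contra hne
    have hne' : ∀ t, ε t ≠ -1 := fun t ht => hne ⟨t, ht⟩
    have ha : ε a = 1 := (h.sign a).resolve_right (hne' a)
    have hb : ε b = 1 := (h.sign b).resolve_right (hne' b)
    obtain ⟨u, hu, e⟩ := h.comm a b
    have hba : ε (b * a) = 1 := by rw [h.eps_mul, hb, ha, mul_one]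
    have k1 : κ u = 0 := by
      have e1 := congrArg κ e
      rw [h.kap_mul, h.kap_mul (b * a), h.kap_mul, ha, hb, hba] at e1
      linear_combination -e1
    rw [h.inK_eq_one hu k1, mul_one] at e
    exact hab e
  obtain ⟨Y, W, I, hY, hW, hI, hind, hcard⟩ := D3_exists_indep_10
  obtain ⟨Y', W', J, hY', hW', hJ, hJind, hJcard⟩ :=
    DihC3Sq.exists_indep_lift h.toD3Hom (h.toD3Hom_surjective ht) hI hind
  refine ⟨Y', W', J, hY'.trans hY, hW'.trans hW, hJ, hJind, ?_⟩
  have hk := h.card_ker_mul ht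
  rw [hJcard, hcard]
  omega

end Coord

/-- **C9 (c), class `[G:Z(G)] = 6`, lower side (kernel).** Every finite group whose centre has index `6` has a `3 × 3` box
`G × Y × W` with an independent cell set `J`, `3|J| = 5|G|` — so with NR154 (`3|I| ≤ 5|G|`) the box ratio of the class is
exactly `5/3`. [folklore] -/
theorem exists_indep_five_thirds_of_index_center_six {G : Type*} [Group G] [Fintype G] [DecidableEq G]
    (h6 : (Subgroup.center G).index = 6) :
    ∃ (Y W : Finset G) (J : Finset (G × G × G)), #Y = 3 ∧ #W = 3 ∧ J ⊆ univ ×ˢ (Y ×ˢ W) ∧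
      (∀ P ∈ J, ∀ P' ∈ J, P ≠ P' → E P P' ≠ 1) ∧ 3 * #J = 5 * Fintype.card G := by
  obtain ⟨c, κ, ε, hc⟩ := exists_coord h6
  obtain ⟨a, b, hab⟩ := exists_not_comm h6
  exact hc.exists_indep_five_thirds_of_ne hab

end Summit.MatrixMultiplication.OmegaCensus.CentreIndexSix
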